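import Summits.PneNP.PneNP.Theses.PermanentDescent
import Literature.Computability.AlgebraicComplexity.PermanentBitsPPoly

/-!
# `PermanentNotInP` (crux stmt-PneNP-16143, route `PermanentDescent`): fibre structure of the crux
# language — the empty word and the high bits are trivially OUT, the bit-0 fibre is a GF(2) determinant
# (negative-side support / tightness, crux-disprover seat; this file does NOT refute the crux)

`PermBits = {⟨s, bin i⟩ : s ∈ {0,1}^{n·n}, bit i of perm_ℕ(M_s) = 1}` (written inline below, exactly as
in the route file). The crux `PermBits ∉ P` quantifies over ALL bit positions `i`; we record which
parts of the language carry no hardness, i.e. which "weakenings" of the crux are false in print and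
what remains formally:

* `nil_not_mem_permBits`, `not_mem_permBits_of_length_lt_two` — words of length `< 2` are not members
  (the guard transducer of line `Sketch`, stub B, outputs `ε` on malformed input and needs exactly this);
* `not_mem_permBits_of_factorial_lt`, `not_mem_permBits_of_sq_lt` — `perm(M_s) ≤ n!`, so `⟨s, bin i⟩`
  is out as soon as `n! < 2^i`, in particular for `i > n²`: members have `|bin i| = O(n log n)`, the
  instance length is `Θ(n²)` (no padding loophole), and the top fibres are trivially in `P`;
* `permanent_eq_det_of_neg_one_eq_one`, `mem_permBits_zero_iff_det` — in characteristic `2` the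
  permanent is the determinant, so the bit-0 fibre `{s : ⟨s, bin 0⟩ ∈ PermBits}` is NONSINGULARITY OVER
  `𝔽₂` of `M_s` — decidable by Gaussian elimination (in `P` in print; the machine is not formalised).
  More generally `perm mod 2^k` is computable with `O(n^{4k-3})` arithmetic operations (Valiant 1979,
  §5), so every fixed-precision slice `i < k` is in `P` in print: a proof of the crux must use bit
  positions that grow with `n` (this is the content of line `Sketch`'s stub C
  `UnboundedPrecisionExponent`, an honest strengthening).

References: L. G. Valiant, *The complexity of computing the permanent*, TCS 8 (1979) 189–201, §5
(perm mod 2^k); S. Arora, B. Barak, *Computational Complexity* (2009), §8.6.2, §17.3.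
-/

noncomputable section

set_option linter.dupNamespace false

namespace Summit.PneNP.PneNP.Theorems.PermanentNotInP.Negative

open Literature.Computability.Complexity Literature.Computability.AlgebraicComplexity
open Summit.PneNP.PneNP.Theses.PermanentDescent Computability

/-- **Parsing `PermBits`**: `⟨s, bin i⟩` is a member iff `|s| = n²` for some `n` and bit `i` of the
permanent of the row-major matrix is `1` (the pairing is injective and `encodeNat` is canonical). [folklore] -/
theorem boolPair_encodeNat_mem_permBits_iff (s : List Bool) (i : ℕ) :
    boolPair s (encodeNat i) ∈ ({w | ∃ (n : ℕ) (s : List Bool) (i : ℕ), s.length = n * n ∧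
        w = boolPair s (encodeNat i) ∧ Nat.testBit (Matrix.permanent (Matrix.of fun a b : Fin n =>
          if s.getD ((b : ℕ) + n * (a : ℕ)) false then (1 : ℕ) else 0)) i = true} : Language Bool) ↔
      ∃ n, s.length = n * n ∧ (Matrix.permanent (Matrix.of fun a b : Fin n =>
          if s.getD ((b : ℕ) + n * (a : ℕ)) false then (1 : ℕ) else 0)).testBit i = true := by
  constructor
  · rintro ⟨n, s', j, hs', hw, hbit⟩
    have h := boolPair_injective (a₁ := (s, encodeNat i)) (a₂ := (s', encodeNat j)) hw
    obtain ⟨rfl, hij⟩ := Prod.mk.inj h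
    have hji : i = j := by simpa [decode_encodeNat] using congrArg decodeNat hij
    subst hji
    exact ⟨n, hs', hbit⟩
  · rintro ⟨n, hs, hbit⟩
    exact ⟨n, s, i, hs, rfl, hbit⟩

/-- On a square payload `|s| = n²` the side is determined, so membership is the bare bit test. [folklore] -/
theorem mem_permBits_iff_of_sq {n : ℕ} {s : List Bool} (hs : s.length = n * n) (i : ℕ) :
    boolPair s (encodeNat i) ∈ ({w | ∃ (n : ℕ) (s : List Bool) (i : ℕ), s.length = n * n ∧
        w = boolPair s (encodeNat i) ∧ Nat.testBit (Matrix.permanent (Matrix.of fun a b : Fin n =>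
          if s.getD ((b : ℕ) + n * (a : ℕ)) false then (1 : ℕ) else 0)) i = true} : Language Bool) ↔
      (Matrix.permanent (Matrix.of fun a b : Fin n =>
          if s.getD ((b : ℕ) + n * (a : ℕ)) false then (1 : ℕ) else 0)).testBit i = true := by
  rw [boolPair_encodeNat_mem_permBits_iff]
  constructor
  · rintro ⟨m, hm, hbit⟩
    have hmn : m = n := Nat.mul_self_inj.mp (hm.symm.trans hs)
    subst hmn
    exact hbit
  · exact fun h => ⟨n, hs, h⟩

/-! ### The empty word and short words -/

/-- **`ε ∉ PermBits`** (every member is a pair, of length `≥ 2`). [folklore] -/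
theorem nil_not_mem_permBits :
    ([] : List Bool) ∉ ({w | ∃ (n : ℕ) (s : List Bool) (i : ℕ), s.length = n * n ∧
        w = boolPair s (encodeNat i) ∧ Nat.testBit (Matrix.permanent (Matrix.of fun a b : Fin n =>
          if s.getD ((b : ℕ) + n * (a : ℕ)) false then (1 : ℕ) else 0)) i = true} : Language Bool) := by
  rintro ⟨n, s, i, -, h, -⟩
  have := congrArg List.length h
  simp [length_boolPair] at this
  omega

/-- No word of length `< 2` is a member. [folklore] -/
theorem not_mem_permBits_of_length_lt_two {w : List Bool} (hw : w.length < 2) :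
    w ∉ ({w | ∃ (n : ℕ) (s : List Bool) (i : ℕ), s.length = n * n ∧
        w = boolPair s (encodeNat i) ∧ Nat.testBit (Matrix.permanent (Matrix.of fun a b : Fin n =>
          if s.getD ((b : ℕ) + n * (a : ℕ)) false then (1 : ℕ) else 0)) i = true} : Language Bool) := by
  rintro ⟨n, s, i, -, h, -⟩
  have := congrArg List.length h
  simp [length_boolPair] at this
  omega

/-! ### High bits: `perm ≤ n!` -/

/-- `perm(M_s) ≤ n!` for the crux's row-major `0/1` matrix. [folklore] -/
theorem permanent_rowMajor_le_factorial (n : ℕ) (s : List Bool) :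
    (Matrix.permanent (Matrix.of fun a b : Fin n =>
        if s.getD ((b : ℕ) + n * (a : ℕ)) false then (1 : ℕ) else 0)) ≤ n.factorial := by
  have h : (Matrix.of fun a b : Fin n => if s.getD ((b : ℕ) + n * (a : ℕ)) false then (1 : ℕ) else 0) =
      Matrix.of fun i j : Fin n => if wordBits s n (i, j) then (1 : ℕ) else 0 := by
    ext i j
    simp [wordBits, Nat.mul_comm, Nat.add_comm]
  have hp := permanent_of_bool ℕ n (wordBits s n)
  rw [Nat.cast_id] at hp
  rw [h, hp]
  exact permCount_le_factorial n _

/-- **High bits vanish**: `⟨s, bin i⟩ ∉ PermBits` whenever `|s| = n²` and `n! < 2^i`. [folklore] -/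
theorem not_mem_permBits_of_factorial_lt {n : ℕ} {s : List Bool} (hs : s.length = n * n) {i : ℕ}
    (hi : n.factorial < 2 ^ i) :
    boolPair s (encodeNat i) ∉ ({w | ∃ (n : ℕ) (s : List Bool) (i : ℕ), s.length = n * n ∧
        w = boolPair s (encodeNat i) ∧ Nat.testBit (Matrix.permanent (Matrix.of fun a b : Fin n =>
          if s.getD ((b : ℕ) + n * (a : ℕ)) false then (1 : ℕ) else 0)) i = true} : Language Bool) := by
  rw [mem_permBits_iff_of_sq hs,
    Nat.testBit_eq_false_of_lt ((permanent_rowMajor_le_factorial n s).trans_lt hi)]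
  exact Bool.false_ne_true

/-- In particular no member has bit index `i > n²` (`n! < 2^{n²+1}`). [folklore] -/
theorem not_mem_permBits_of_sq_lt {n : ℕ} {s : List Bool} (hs : s.length = n * n) {i : ℕ}
    (hi : n * n < i) :
    boolPair s (encodeNat i) ∉ ({w | ∃ (n : ℕ) (s : List Bool) (i : ℕ), s.length = n * n ∧
        w = boolPair s (encodeNat i) ∧ Nat.testBit (Matrix.permanent (Matrix.of fun a b : Fin n =>
          if s.getD ((b : ℕ) + n * (a : ℕ)) false then (1 : ℕ) else 0)) i = true} : Language Bool) :=
  not_mem_permBits_of_factorial_lt hs ((factorial_lt_two_pow_mul_succ n).trans_le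
    (Nat.pow_le_pow_right (by norm_num) hi))

/-! ### The bit-0 fibre is a GF(2) determinant -/

/-- Ring homomorphisms commute with the permanent. [folklore] -/
theorem map_permanent {R S : Type*} [CommSemiring R] [CommSemiring S] (f : R →+* S) {m : Type*}
    [Fintype m] [DecidableEq m] (M : Matrix m m R) : f M.permanent = (M.map f).permanent := by
  unfold Matrix.permanent
  simp [map_sum, map_prod]

/-- **In a ring with `-1 = 1` the permanent is the determinant.** [folklore] -/
theorem permanent_eq_det_of_neg_one_eq_one {R : Type*} [CommRing R] (h : (-1 : R) = 1) {m : Type*}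
    [Fintype m] [DecidableEq m] (M : Matrix m m R) : M.permanent = M.det := by
  rw [Matrix.det_apply]
  unfold Matrix.permanent
  refine Finset.sum_congr rfl fun σ _ => ?_
  rcases Int.units_eq_one_or (Equiv.Perm.sign σ) with hσ | hσ
  · rw [hσ, one_smul]
  · rw [hσ, Units.neg_smul, one_smul, neg_eq_neg_one_mul, h, one_mul]

/-- `testBit m 0` is the parity of `m`. [folklore] -/
theorem testBit_zero_eq_true_iff_cast (m : ℕ) : m.testBit 0 = true ↔ (m : ZMod 2) = 1 := by
  rw [Nat.testBit_zero, decide_eq_true_eq, show (1 : ZMod 2) = ((1 : ℕ) : ZMod 2) by simp,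
    ZMod.natCast_eq_natCast_iff', Nat.one_mod]

/-- **The bit-0 fibre of `PermBits` is nonsingularity over `𝔽₂`**: for `|s| = n²`,
`⟨s, bin 0⟩ ∈ PermBits ↔ det_{𝔽₂}(M_s) = 1`. So the slice `i = 0` is a Gaussian elimination, and a
proof of the crux must use higher (indeed, by Valiant 1979 §5, unboundedly many) bit positions.
[cite: Valiant1979, §5] -/
theorem mem_permBits_zero_iff_det {n : ℕ} {s : List Bool} (hs : s.length = n * n) :
    boolPair s (encodeNat 0) ∈ ({w | ∃ (n : ℕ) (s : List Bool) (i : ℕ), s.length = n * n ∧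
        w = boolPair s (encodeNat i) ∧ Nat.testBit (Matrix.permanent (Matrix.of fun a b : Fin n =>
          if s.getD ((b : ℕ) + n * (a : ℕ)) false then (1 : ℕ) else 0)) i = true} : Language Bool) ↔
      ((Matrix.of fun a b : Fin n =>
          if s.getD ((b : ℕ) + n * (a : ℕ)) false then (1 : ℕ) else 0).map (Nat.cast : ℕ → ZMod 2)).det = 1 := by
  set M : Matrix (Fin n) (Fin n) ℕ :=
    Matrix.of fun a b : Fin n => if s.getD ((b : ℕ) + n * (a : ℕ)) false then (1 : ℕ) else 0 with hM
  have hmap : ((M.permanent : ℕ) : ZMod 2) = (M.map (Nat.cast : ℕ → ZMod 2)).permanent := by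
    simpa only [Nat.coe_castRingHom] using map_permanent (Nat.castRingHom (ZMod 2)) M
  rw [mem_permBits_iff_of_sq hs, testBit_zero_eq_true_iff_cast, hmap,
    permanent_eq_det_of_neg_one_eq_one (by decide)]

end Summit.PneNP.PneNP.Theorems.PermanentNotInP.Negative

end
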